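/-
Copyright: lit-balaban reader/typer seat r18 (gen 9), C2 §§1–4 fold owner.  Statement-level skeleton of a published paper; no proof
claims beyond what the kernel checks below.
-/
import Literature.MathematicalPhysics.QuantumFieldTheory.BalabanImbrieJaffe1984to88.BIJ88Normalization46Torus

/-!
# `BalabanImbrieJaffe1984to88.BIJ88Eq47Scaling` — T. Bałaban, J. Imbrie, A. Jaffe, *Effective action and cluster properties of the
abelian Higgs model*, Commun. Math. Phys. **114** (1988) 257–315 [BalabanImbrieJaffe1988], p. 275 [PDF 19], the sentence between (4.6)
and (4.7): *"We have included a constant factor to take care of the scalings and make this independent of k. It is defined using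
E^{(j)}_{k,v} = −log[(e_j/2π)(L^jη)^{(d−2)/2}]. (4.7)"* — **THE SCALING LAW OF THE GAUSSIAN NORMALIZATION FACTOR (4.6) AND THE
COMPENSATION BY (4.7)**, kernel-checked in the finite-dimensional model of record (`BIJ88Normalization46.Z46` over the tree's
`Beta.ConstrainedGaussian`) and for the concrete torus datum `BIJ88Normalization46Torus.cg46`.

statement-level skeleton of published theorems with citation tags; proofs where landed; nothing here is a claim about the Yang–Mills mass gap

PDF held: `paper:balaban1988-cmp114-bij-abelian-higgs-effective-action` (journal page = PDF page + 256); p. 275 [PDF 19] text layer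
re-read this session (`~/.lit/texts/paper-balaban1988-cmp114-bij-abelian-higgs-effective-action/p0019.txt`): the sentence above, (4.6),
(4.7), (4.8) *"Here ‖Λ₁₀^{(j)c*c}‖ is the number of free integrations in Λ₁₀^{(j)c*c} after enforcing the δ-functions."*; p. 261 [PDF 5]
(2.12): *"Superscripts L^jη, η, etc. indicate the lattice spacing for operators rescaled to nonstandard lattices."*

CITATION HEADER (lean-in-tree rule).  Part of the lit-balaban TYPED SKELETON (HOME `run/shared/lean/pub/lit-balaban/`): rows **C2.Eq4.6** /
**C2.Eq4.7** of `HOME/lit-balaban-r18/ROWS-C2.md` (fold owner r18; (4.6) head `proved p256012`, (4.7) a DEF row `BIJ88Sect4Statements.Ekv`);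
r18 gen 2's `BIJ88Normalization46` lists among its NOT-HERE items *"the claim that the constants make Z «independent of k»"* — this file
proves the located p. 275 sentence in the following precise form.  Unit `lit-balaban-r18` (literature-prover-lit-balaban-r18-g9-0), gen 9.

THE READING.  In (4.6) the level-`j` gauge-field factor is an integral over a field `A` *"on the L^jη-lattice"* — at step `k` a lattice of
spacing `ξ = L^jη = L^{j−k}` — of `exp(−½⟨ΛA, ∂*σ^{L^jη}_{j,loc}∂ΛA⟩)` against the δ-functions `δ_{Ax}δ(Q·)`, times `exp(−E^{(j)}_{k,v}‖Λ‖)`.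
As `k` grows the SAME level-`j` factor is seen on finer and finer lattices: by (2.12) the quadratic form is the step-`j` form RESCALED to
spacing `ξ`, which for the precision of a field of scaling dimension `(length)^{−(d−2)/2}` multiplies the precision matrix (in the
integration coordinates `A_b`, whose Lebesgue/Haar normalisation `du_b = (e/2π)dA_b` does not change with `k`) by `ξ^{d−2}` — the inverse
of the covariance factor `ξ^{2−d}` of r18's dictionary (`BIJ88Decay216Native.cE_ambient_eq_native`, `BIJ85Prop522Rescaling.dkE_eta_eq`); the
δ-functions (linear constraints `K`) are unchanged.  The model of record evaluates (4.6) as `Z = e^{−E‖Λ‖}(2π)^{‖Λ‖/2}|det[[Δ,Kᵀ],[K,0]]|^{−1/2}`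
(`BIJ88Normalization46.Z46_eq`, `‖Λ‖ = n − m` = (4.8)).  WHAT IS PROVED (theorems only; 0 `sorry`; standard axioms):
* §1 (generic `Beta.ConstrainedGaussian n m`, precision rescaled `Δ ↦ a•Δ`, constraints kept): private `kkt_eq_of_smul` (the bordered
  matrix is `diag(a·1, 1)·[[Δ,Kᵀ],[K,0]]·diag(1, a⁻¹·1)`), **`kkt_det_of_smul`** (`det′ = aⁿ·a⁻ᵐ·det`), `regular_of_smul`/`regular_iff_of_smul`
  (`Regular` is scale invariant, `a > 0`), `det_kkt_ne_zero` (under `Regular`, from the tree's `exp_logZ`), **`Z46_of_smul`**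
  (`Z′ = a^{−(n−m)/2}·Z`: THE SCALING LAW), `log_Z46_of_smul`.
* §2 **THE COMPENSATION = the printed sentence**: `log_Z46_Ekv_of_smul` / **`Z46_Ekv_of_smul`** — if the step-`k` datum of the level-`j`
  factor has the step-`j` constraints and `ξ^{d−2}` times the step-`j` precision (`ξ = L^jη > 0`, `d ≥ 2`), then with the constant (4.7)
  `E^{(j)}_{k,v} = −log[(e_j/2π)ξ^{(d−2)/2}]` and `‖Λ‖ = n − m` free integrations the normalization factor EQUALS its step-`j` value (the one
  with `ξ = 1`, `E = −log(e_j/2π)`): `Z46 Z′ (Ekv e_j ξ d) ‖Λ‖ = Z46 Z (Ekv e_j 1 d) ‖Λ‖` — *"independent of k"*.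
* §3 THE TORUS DATUM: for r18 gen 7's concrete `cg46 S σ c` (region `S`, linear plaquette operator `σ`, curl factor `c`):
  `curlL_smul` (`∂^{s·c} = s·∂^{c}`), `pform_smul`, **`cg46_smul_Δ`** (`(cg46 S (t•σ) (s·c)).Δ = (t·s²)•(cg46 S σ c).Δ`), `cg46_smul_Q` (same
  δ-functions, `rfl`), hence `regular_cg46_smul_iff`, **`Z46_cg46_smul`** (`Z` scales by `(t·s²)^{−‖Λ‖/2}`, `‖Λ‖ = dim free48 S` = (4.8) by
  r18 gen 5's count) and **`Z46_cg46_Ekv_indep`** (with `t·s² = ξ^{d−2}`: `e^{−E^{(j)}_{k,v}‖Λ‖}·Z` at spacing `ξ` = the same at spacing `1`).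
HONEST SCOPE.  (i) The print does not spell out the step-`k` form of the level-`j` factor; the hypothesis «precision × `ξ^{d−2}`, constraints
unchanged» IS the (2.12) rescaling convention for a precision (the exponent `d − 2` is the one of (4.7) doubled, and the inverse of the
covariance exponent `2 − d` of the cell's dictionary) and is DISPLAYED as a hypothesis (`hΔ`, or the relation `t·s² = ξ^{d−2}` on the torus),
not derived from a rescaling map on densities (p34's `BIJ88RTIterated.scaleStep` acts on the block-field densities, not on these factors).
(ii) `e_j` enters (4.7) as a letter (`0 < e_j`); its own `k`-independence is definitional ((2.2) at level `j`).  (iii) Nothing here bounds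
`Z`; no row head changes ((4.7) is a DEF row; the sentence is recorded in its cell).  No `def`, no new named fact, nothing restated.
-/

namespace Literature.MathematicalPhysics.QuantumFieldTheory.BalabanImbrieJaffe1984to88.BIJ88Eq47Scaling

open Matrix
open Literature.MathematicalPhysics.QuantumFieldTheory.Balaban1983to89
open Literature.MathematicalPhysics.QuantumFieldTheory.Balaban1983to89.Beta
open BIJ88Normalization46 (Z46 Z46_eq Z46_pos log_Z46)
open BIJ88Sect4Statements (Ekv)

noncomputable section

/-! ## §1  A constrained Gaussian with its precision rescaled and its constraints kept -/

section Generic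

variable {n m : ℕ} {Z Z' : ConstrainedGaussian n m} {a : ℝ}

/-- the bordered matrix of the rescaled datum `(K, a•Δ)` is `diag(a·1, 1)·[[Δ, Kᵀ], [K, 0]]·diag(1, a⁻¹·1)` (`a ≠ 0`). [folklore] -/
private theorem kkt_eq_of_smul (hQ : Z'.Q = Z.Q) (hΔ : Z'.Δ = a • Z.Δ) (ha : a ≠ 0) :
    Z'.kkt = Matrix.fromBlocks (a • (1 : Matrix (Fin n) (Fin n) ℝ)) 0 0 (1 : Matrix (Fin m) (Fin m) ℝ) * Z.kkt *
      Matrix.fromBlocks (1 : Matrix (Fin n) (Fin n) ℝ) 0 0 (a⁻¹ • (1 : Matrix (Fin m) (Fin m) ℝ)) := by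
  rw [ConstrainedGaussian.kkt, ConstrainedGaussian.kkt, hQ, hΔ, Matrix.fromBlocks_multiply, Matrix.fromBlocks_multiply]
  simp only [Matrix.smul_mul, Matrix.mul_smul, Matrix.one_mul, Matrix.mul_one, Matrix.zero_mul, Matrix.mul_zero, add_zero,
    zero_add, smul_zero, smul_smul, inv_mul_cancel₀ ha, one_smul]

/-- **`det[[a•Δ, Kᵀ], [K, 0]] = aⁿ·a⁻ᵐ·det[[Δ, Kᵀ], [K, 0]]`** (`a ≠ 0`) — the determinant in the evaluated (4.6)
`Z = e^{−E‖Λ‖}(2π)^{(n−m)/2}|det[[Δ, Kᵀ],[K, 0]]|^{−1/2}` under a rescaling of the precision at fixed δ-functions.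
[cite: BalabanImbrieJaffe1988, (4.6) p.275] -/
theorem kkt_det_of_smul (hQ : Z'.Q = Z.Q) (hΔ : Z'.Δ = a • Z.Δ) (ha : a ≠ 0) :
    Z'.kkt.det = a ^ n * a⁻¹ ^ m * Z.kkt.det := by
  rw [kkt_eq_of_smul hQ hΔ ha, Matrix.det_mul, Matrix.det_mul, Matrix.det_fromBlocks_zero₂₁, Matrix.det_fromBlocks_zero₂₁,
    Matrix.det_smul, Matrix.det_smul, Matrix.det_one, Matrix.det_one, Fintype.card_fin, Fintype.card_fin]
  ring

/-- `Regular` (constraints onto, precision symmetric and positive on the constraint kernel — the regime in which (4.6) is a convergent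
δ-constrained Gaussian integral) is preserved under `Δ ↦ a•Δ`, `a > 0`. [cite: BalabanImbrieJaffe1988, (4.6) p.275] -/
theorem regular_of_smul (hQ : Z'.Q = Z.Q) (hΔ : Z'.Δ = a • Z.Δ) (ha : 0 < a) (hZ : Z.Regular) : Z'.Regular where
  onto := by rw [hQ]; exact hZ.onto
  symm := by rw [hΔ]; exact hZ.symm.smul a
  posKer v hv hQv := by
    rw [hQ] at hQv
    rw [hΔ, Matrix.smul_mulVec, dotProduct_smul, smul_eq_mul]
    exact mul_pos ha (hZ.posKer v hv hQv)

/-- the regime of (4.6) is INVARIANT under `Δ ↦ a•Δ`, `a > 0` (converse by rescaling with `a⁻¹`). [cite: BalabanImbrieJaffe1988, (4.6) p.275] -/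
theorem regular_iff_of_smul (hQ : Z'.Q = Z.Q) (hΔ : Z'.Δ = a • Z.Δ) (ha : 0 < a) : Z'.Regular ↔ Z.Regular := by
  refine ⟨fun hZ' => ?_, regular_of_smul hQ hΔ ha⟩
  have hΔ' : Z.Δ = a⁻¹ • Z'.Δ := by rw [hΔ, smul_smul, inv_mul_cancel₀ ha.ne', one_smul]
  exact regular_of_smul hQ.symm hΔ' (inv_pos.2 ha) hZ'

/-- in the regime of (4.6) the bordered matrix `[[Δ, Kᵀ],[K, 0]]` of its closed form is invertible (its determinant is not zero) —
read off the tree's evaluation `exp logZ = (2π)^{(n−m)/2}|det|^{−1/2} > 0`. [cite: BalabanImbrieJaffe1988, (4.6) p.275] -/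
theorem det_kkt_ne_zero (hZ : Z.Regular) : Z.kkt.det ≠ 0 := by
  intro h
  have h1 := ConstrainedGaussian.exp_logZ Z hZ
  rw [h, abs_zero, Real.zero_rpow (by norm_num), mul_zero] at h1
  exact (Real.exp_pos _).ne' h1

/-- `aⁿ·a⁻ᵐ = a^{n−m}` as a real power (`a > 0`). [folklore] -/
private theorem pow_mul_inv_pow_eq_rpow (ha : 0 < a) : a ^ n * a⁻¹ ^ m = a ^ ((n : ℝ) - m) := by
  rw [Real.rpow_sub ha, Real.rpow_natCast, Real.rpow_natCast, inv_pow, div_eq_mul_inv]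

/-- **THE SCALING LAW OF (4.6)**: rescaling the precision by `a > 0` at fixed δ-functions multiplies the normalization factor by
`a^{−(n−m)/2}` — one factor `a^{−1/2}` per FREE integration (`n − m` of them, (4.8)). [cite: BalabanImbrieJaffe1988, (4.6) p.275] -/
theorem Z46_of_smul (hQ : Z'.Q = Z.Q) (hΔ : Z'.Δ = a • Z.Δ) (ha : 0 < a) (hZ : Z.Regular) (E N : ℝ) :
    Z46 Z' E N = (a ^ (((n : ℝ) - m) / 2))⁻¹ * Z46 Z E N := by
  have hZ' := regular_of_smul hQ hΔ ha hZ
  have hx : 0 ≤ a ^ n * a⁻¹ ^ m := by positivity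
  rw [Z46_eq Z' hZ' E N, Z46_eq Z hZ E N, kkt_det_of_smul hQ hΔ ha.ne', abs_mul, abs_of_nonneg hx,
    Real.mul_rpow hx (abs_nonneg _), pow_mul_inv_pow_eq_rpow ha, ← Real.rpow_mul ha.le, ← Real.rpow_neg ha.le]
  have : ((n : ℝ) - m) * (-(1 / 2 : ℝ)) = -(((n : ℝ) - m) / 2) := by ring
  rw [this]
  ring

/-- the scaling law in logarithmic form: `log Z′ = log Z − ((n−m)/2)·log a`. [cite: BalabanImbrieJaffe1988, (4.6) p.275] -/
theorem log_Z46_of_smul (hQ : Z'.Q = Z.Q) (hΔ : Z'.Δ = a • Z.Δ) (ha : 0 < a) (hZ : Z.Regular) (E N : ℝ) :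
    Real.log (Z46 Z' E N) = Real.log (Z46 Z E N) - ((n : ℝ) - m) / 2 * Real.log a := by
  rw [Z46_of_smul hQ hΔ ha hZ E N, Real.log_mul (inv_pos.2 (Real.rpow_pos_of_pos ha _)).ne' (Z46_pos Z hZ E N).ne',
    Real.log_inv, Real.log_rpow ha]
  ring

end Generic

/-! ## §2  The compensation by the constant (4.7): *"make this independent of k"* -/

section Compensation

variable {n m : ℕ} {Z Z' : ConstrainedGaussian n m} {ξ : ℝ} {d : ℕ}

/-- `(ξ^{d−2} : ℕ-power) = ξ^{(d:ℝ)−2}` for `d ≥ 2`, `ξ > 0`. [folklore] -/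
private theorem pow_sub_two_eq_rpow (hd : 2 ≤ d) (ξ : ℝ) : ξ ^ (d - 2) = ξ ^ ((d : ℝ) - 2) := by
  rw [← Real.rpow_natCast, Nat.cast_sub hd, Nat.cast_two]

/-- **THE p.275 SENTENCE, logarithmic form**: if the step-`k` datum `Z′` of the level-`j` Gaussian factor has the step-`j` δ-functions and
`ξ^{d−2}` times the step-`j` precision (`ξ = L^jη > 0`, the (2.12) rescaling of a precision; `d ≥ 2`), then with the constant (4.7)
`E^{(j)}_{k,v} = −log[(e_j/2π)ξ^{(d−2)/2}]` and `‖Λ‖ = n − m` free integrations, `log Z` takes its step-`j` value (`ξ = 1`):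
*"We have included a constant factor to take care of the scalings and make this independent of k."* [cite: BalabanImbrieJaffe1988, (4.7) p.275] -/
theorem log_Z46_Ekv_of_smul (hQ : Z'.Q = Z.Q) (hΔ : Z'.Δ = (ξ ^ (d - 2)) • Z.Δ) (hξ : 0 < ξ) (hd : 2 ≤ d) (hZ : Z.Regular)
    {ej : ℝ} (hej : 0 < ej) {N : ℝ} (hN : (n : ℝ) - m = N) :
    Real.log (Z46 Z' (Ekv ej ξ d) N) = Real.log (Z46 Z (Ekv ej 1 d) N) := by
  have ha : 0 < ξ ^ (d - 2) := pow_pos hξ _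
  have hZ' := regular_of_smul hQ hΔ ha hZ
  rw [BIJ88Normalization46.log_Z46_Ekv Z' hZ' hej hξ d N hN, BIJ88Normalization46.log_Z46_Ekv Z hZ hej one_pos d N hN,
    kkt_det_of_smul hQ hΔ ha.ne', abs_mul, abs_of_nonneg (by positivity : (0 : ℝ) ≤ (ξ ^ (d - 2)) ^ n * (ξ ^ (d - 2))⁻¹ ^ m),
    Real.log_mul (by positivity) (abs_pos.2 (det_kkt_ne_zero hZ)).ne', pow_mul_inv_pow_eq_rpow ha, Real.log_rpow ha,
    Real.log_one, pow_sub_two_eq_rpow hd ξ, Real.log_rpow hξ, hN]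
  ring

/-- **THE p.275 SENTENCE**: under the same hypotheses `Z46 Z′ (E^{(j)}_{k,v}) ‖Λ‖ = Z46 Z (E^{(j)}_{j,v}) ‖Λ‖` — the level-`j` Gaussian
normalization factor of (4.6), with its constant (4.7), does not depend on the step `k` at which it is read.
[cite: BalabanImbrieJaffe1988, (4.7) p.275] -/
theorem Z46_Ekv_of_smul (hQ : Z'.Q = Z.Q) (hΔ : Z'.Δ = (ξ ^ (d - 2)) • Z.Δ) (hξ : 0 < ξ) (hd : 2 ≤ d) (hZ : Z.Regular)
    {ej : ℝ} (hej : 0 < ej) {N : ℝ} (hN : (n : ℝ) - m = N) :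
    Z46 Z' (Ekv ej ξ d) N = Z46 Z (Ekv ej 1 d) N := by
  have hZ' := regular_of_smul hQ hΔ (pow_pos hξ _) hZ
  rw [← Real.exp_log (Z46_pos Z' hZ' _ _), log_Z46_Ekv_of_smul hQ hΔ hξ hd hZ hej hN, Real.exp_log (Z46_pos Z hZ _ _)]

end Compensation

/-! ## §3  The torus datum of (4.6): how `cg46 S σ c` scales with the precision operator and the curl factor -/

section Torus

open BIJ88Normalization46Torus
open BIJ88FreeCount48 (free48)
open LatticeFieldCalculus (curl)

variable {P : Params} {j : ℕ} (S : Finset (Balaban1983to89.Site P (j + 1)))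
  (σ : (Balaban1983to89.Plaq P j → ℝ) →ₗ[ℝ] (Balaban1983to89.Plaq P j → ℝ)) (c : ℝ)

/-- the lattice curl is linear in its factor: `∂^{s·c} = s·∂^{c}`. [cite: Balaban1984PropagatorsI, (1.2) p.18] -/
theorem curlL_smul (s : ℝ) (A : VecField P j ℝ) : curlL P j (s * c) A = s • curlL P j c A := by
  funext p
  simp only [curlL_apply, curl, Pi.smul_apply, smul_eq_mul]
  ring

/-- the precision form of (4.6) scales by `t·s²` under `σ ↦ t•σ`, `c ↦ s·c`. [cite: BalabanImbrieJaffe1988, (4.6) p.275] -/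
theorem pform_smul (t s : ℝ) : pform S (t • σ) (s * c) = (t * s ^ 2) • pform S σ c := by
  refine LinearMap.ext fun v => LinearMap.ext fun w => ?_
  rw [LinearMap.smul_apply, LinearMap.smul_apply, pform_apply, pform_apply, curlL_smul, curlL_smul, LinearMap.smul_apply,
    map_smul, smul_dotProduct, dotProduct_smul, dotProduct_smul, smul_eq_mul, smul_eq_mul, smul_eq_mul, smul_eq_mul]
  ring

/-- **the precision MATRIX of the torus datum scales by `t·s²`**: `(cg46 S (t•σ) (s·c)).Δ = (t·s²)•(cg46 S σ c).Δ`.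
[cite: BalabanImbrieJaffe1988, (4.6) p.275] -/
theorem cg46_smul_Δ (t s : ℝ) : (cg46 S (t • σ) (s * c)).Δ = (t * s ^ 2) • (cg46 S σ c).Δ := by
  show LinearMap.BilinForm.toMatrix' (pform S (t • σ) (s * c)) = (t * s ^ 2) • LinearMap.BilinForm.toMatrix' (pform S σ c)
  rw [pform_smul, map_smul]

/-- the δ-functions of the torus datum do not see `σ`, `c`. [cite: BalabanImbrieJaffe1988, (4.6) p.275] -/
theorem cg46_smul_Q (t s : ℝ) : (cg46 S (t • σ) (s * c)).Q = (cg46 S σ c).Q := rfl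

/-- `Regular` for the torus datum is invariant under `σ ↦ t•σ`, `c ↦ s·c` with `t·s² > 0`. [cite: BalabanImbrieJaffe1988, (4.6) p.275] -/
theorem regular_cg46_smul_iff {t s : ℝ} (hts : 0 < t * s ^ 2) : (cg46 S (t • σ) (s * c)).Regular ↔ (cg46 S σ c).Regular :=
  regular_iff_of_smul (cg46_smul_Q S σ c t s) (cg46_smul_Δ S σ c t s) hts

/-- **THE SCALING LAW OF (4.6) ON THE TORUS**: `Z[t•σ, s·c] = (t·s²)^{−‖Λ‖/2}·Z[σ, c]` with `‖Λ‖ = dim free48 S` the (4.8) count of free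
integrations (r18 gen 5 `BIJ88FreeCount48`), for every `Regular` datum, `t·s² > 0`, every constant `E`.
[cite: BalabanImbrieJaffe1988, (4.6) p.275] -/
theorem Z46_cg46_smul (hj : j + 1 ≤ P.m + P.K) {t s : ℝ} (hts : 0 < t * s ^ 2) (hreg : (cg46 S σ c).Regular) (E : ℝ) :
    Z46 (cg46 S (t • σ) (s * c)) E (Module.finrank ℝ (free48 S)) =
      ((t * s ^ 2) ^ ((Module.finrank ℝ (free48 S) : ℝ) / 2))⁻¹ * Z46 (cg46 S σ c) E (Module.finrank ℝ (free48 S)) := by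
  rw [Z46_of_smul (cg46_smul_Q S σ c t s) (cg46_smul_Δ S σ c t s) hts hreg, nVar_sub_nCon_eq_finrank S hj]

/-- **(4.6)–(4.7) ON THE TORUS: "independent of k"** — if the step-`k` view of the level-`j` factor is the torus datum with precision
operator `t•σ` and curl factor `s·c` where `t·s² = ξ^{d−2}`, `ξ = L^jη > 0` (the (2.12) rescaling of the precision of (4.6)), then with
the constant (4.7) at `L^jη = ξ` it equals the step-`j` factor (`σ`, `c`, constant (4.7) at `L^jη = 1`), for every region `S`
(`j + 1 ≤ m + K`, `e_j > 0`, `Regular` datum — e.g. r18's `regular_cg46_sigmaTorus` for the σ_j of record).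
[cite: BalabanImbrieJaffe1988, (4.7) p.275] -/
theorem Z46_cg46_Ekv_indep (hj : j + 1 ≤ P.m + P.K) (hd : 2 ≤ P.d) {t s ξ : ℝ} (hξ : 0 < ξ) (hts : t * s ^ 2 = ξ ^ (P.d - 2))
    (hreg : (cg46 S σ c).Regular) {ej : ℝ} (hej : 0 < ej) :
    Z46 (cg46 S (t • σ) (s * c)) (Ekv ej ξ P.d) (Module.finrank ℝ (free48 S)) =
      Z46 (cg46 S σ c) (Ekv ej 1 P.d) (Module.finrank ℝ (free48 S)) :=
  Z46_Ekv_of_smul (cg46_smul_Q S σ c t s) (by rw [cg46_smul_Δ, hts]) hξ hd hreg hej (nVar_sub_nCon_eq_finrank S hj)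

end Torus

end

end Literature.MathematicalPhysics.QuantumFieldTheory.BalabanImbrieJaffe1984to88.BIJ88Eq47Scaling
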